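import Summits.AtomisticToContinuum.HydrodynamicLimit.Theorems.BoxDissipativeWeakStrongFluxClosureEqKinStaticGauss
import Summits.AtomisticToContinuum.HydrodynamicLimit.Theorems.BoxDissipativeWeakStrongFluxClosureKinDevAEMeasurable
import Summits.AtomisticToContinuum.HydrodynamicLimit.Theorems.BoxDissipativeWeakStrongLocalGibbsFineScaleVelocity
import Summits.AtomisticToContinuum.HydrodynamicLimit.Theorems.BoxDissipativeWeakStrongLocalGibbsFineScaleStaticsMain
import Literature.MathematicalPhysics.KineticTheory.HardSphereEulerProofs
import HarnessLib

/-!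
# Crux `FluxClosure` (stmt-AtomisticToContinuum-9902, route BoxDissipativeWeakStrong), line `registered`:
# Gaussian statics of the kinetic-isotropy integrand under the homogeneous local Gibbs measure (rung-0 piece E6)

Support file (`--supports stmt-AtomisticToContinuum-9902`) of the lead prover's rung-0 (global equilibrium)
programme for the crux `Summit.AtomisticToContinuum.HydrodynamicLimit.Theses.BoxDissipativeWeakStrong.FluxClosure`.
It proves the registered sub-goal E6 `kineticIsotropy_static_homogeneous`, the STATIC heart of the kinetic stub K in
equilibrium: under the homogeneous local Gibbs MEASURE `localGibbsMeasure σ a u θ N` (constant profiles, `σ ≤ 1/2`)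
the traceless box peculiar velocity covariance `A = Ŝ - m̂⊗m̂/ρ̂ - ρ̂θ̂𝟙` of the cube-kernel box fields at window `l`,
tested against a bounded matrix field `G` (`|Gᵢⱼ| ≤ B`), has
`E |∫ₓ Σᵢⱼ Aᵢⱼ Gᵢⱼ dx| ≤ C B (((N+1)l³)^{-1/2} + ((N+1)l³)⁻¹)` with `C = C(θ)` — no dynamics, no flow.

* `kinStatic_lintegral_vel_le` — GIVEN THE POSITIONS the velocities are i.i.d. `N(u, θ𝟙)` (`velMeasure`); by the
  traceless identity of file `…EqKinStaticGauss`, Bienaymé for the independent centred variables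
  `Zᵢⱼ = n⁻¹Σ_a χ(q_a)((v_a - u)ᵢ(v_a - u)ⱼ - θδᵢⱼ)` (`MesoLLN.integral_sq_sum_sub_pi`), Cauchy–Schwarz, `χ² ≤ C_χ χ`
  and the second moments of the momentum fluctuation (`MesoLLN.integral_momCoord_sq`):
  `E_v Σᵢⱼ|Aᵢⱼ| ≤ 9 √(n⁻¹C_χθ²M₄) (1 + ρ̂) + 36 n⁻¹C_χθ` for every weight `0 ≤ χ ≤ C_χ`.
* `kinStatic_lintegral_localGibbs_le` — for a general jointly measurable kernel `0 ≤ K ≤ C_K` of unit mass in its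
  centre variable: `|∫ₓ| ≤ ∫ₓ|·|` (`LGFS.ofReal_integral_le_lintegral_ofReal'`), Tonelli (joint measurability `FluxClosureB5.measurable_kinDevIntegrand`), the
  disintegration `lintegral_localGibbsMeasure`, the conditional bound made uniform in the positions by
  `∫ₓ ρ̂(q, x) dx = 1`, and `lintegral_posWeight_eq_one`.
* `kineticIsotropy_static_homogeneous` — the cube kernel `K_l` (`0 ≤ K_l ≤ l⁻³`, `∫ₓ K_l(x, q) dx = 1`).

No definitions. References: H. Spohn, *Large Scale Dynamics of Interacting Particles* (1991), Part I §2.3, §3.3.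
-/

noncomputable section

namespace Summit.AtomisticToContinuum.HydrodynamicLimit.Theorems
namespace FluxClosureEq.E6

open scoped BigOperators Topology Classical MeasureTheory ProbabilityTheory InnerProductSpace ENNReal
open Filter Set Function MeasureTheory ProbabilityTheory
open Literature.MathematicalPhysics.KineticTheory Literature.Analysis.FluidPDE Literature.Analysis.FunctionSpaces
open Summit.AtomisticToContinuum.HydrodynamicLimit.Theses.BoxDissipativeWeakStrong

variable {n : ℕ}

/-! ### Gaussian statics given the positions -/

/-- **Conditional (velocity) bound.** Given positions `q` of `n` particles and a weight `0 ≤ χ ≤ C_χ`, under the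
Maxwellian velocity law `⊗ₐ N(u, θ𝟙)` the summed absolute K-integrand of `zipConfig (q, v)` has expectation at
most `9 √(n⁻¹ C_χ θ² M₄) (1 + ρ̂) + 36 n⁻¹ C_χ θ` (`ρ̂ = n⁻¹Σ_a χ(q_a)`, `M₄ = E‖w‖⁴`): Bienaymé for the
independent centred `Z`-variables (`MesoLLN.integral_sq_sum_sub_pi`), Cauchy–Schwarz, `χ² ≤ C_χ χ`, and the
second moments of the momentum fluctuation (`MesoLLN.integral_momCoord_sq`). -/
theorem kinStatic_lintegral_vel_le {u : V3} {θ : ℝ} (hθ : 0 < θ) (q : Fin n → T3) {χ : T3 → ℝ} {Cχ : ℝ}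
    (hχ0 : ∀ y, 0 ≤ χ y) (hχC : ∀ y, χ y ≤ Cχ) :
    ∫⁻ v, ENNReal.ofReal (∑ i, ∑ j,
      |(∫ y, χ y.1 * (y.2 i * y.2 j) ∂(empiricalMeasure (zipConfig (q, v)))) -
        empiricalMomentumField (zipConfig (q, v)) χ i * empiricalMomentumField (zipConfig (q, v)) χ j /
          empiricalDensityField (zipConfig (q, v)) χ -
        (if i = j then empiricalDensityField (zipConfig (q, v)) χ *
          (2 / 3 * (empiricalEnergyField (zipConfig (q, v)) χ / empiricalDensityField (zipConfig (q, v)) χ -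
            ‖empiricalMomentumField (zipConfig (q, v)) χ‖ ^ 2 / (2 * empiricalDensityField (zipConfig (q, v)) χ ^ 2)))
        else 0)|) ∂(velMeasure (fun _ => u) (fun _ => θ) q) ≤
      ENNReal.ofReal (9 * (Real.sqrt ((n : ℝ)⁻¹ * Cχ * (θ ^ 2 * ∫ w, ‖w‖ ^ 4 ∂stdGaussian V3)) *
          (1 + (n : ℝ)⁻¹ * ∑ a, χ (q a))) + 36 * ((n : ℝ)⁻¹ * Cχ * θ)) := by
  -- abbreviations: the (velocity-independent) density, the fourth moment, the velocity law
  obtain ⟨R, hR⟩ : ∃ R : ℝ, R = (n : ℝ)⁻¹ * ∑ a, χ (q a) := ⟨_, rfl⟩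
  obtain ⟨M₄, hM₄⟩ : ∃ M : ℝ, M = ∫ w, ‖w‖ ^ 4 ∂stdGaussian V3 := ⟨_, rfl⟩
  rw [← hR, ← hM₄]
  have hμv : velMeasure (fun _ => u) (fun _ => θ) q = Measure.pi fun _ : Fin n => gaussMeasure u θ := rfl
  have hκ0 : ∀ a, 0 ≤ χ (q a) := fun a => hχ0 _
  have hκC : ∀ a, χ (q a) ≤ Cχ := fun a => hχC _
  have hCχ : 0 ≤ Cχ := (hχ0 0).trans (hχC 0)
  have hc0 : 0 ≤ (n : ℝ)⁻¹ := inv_nonneg.2 (Nat.cast_nonneg n)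
  have hR0 : 0 ≤ R := by rw [hR]; exact mul_nonneg hc0 (Finset.sum_nonneg fun a _ => hκ0 a)
  have hM₄0 : 0 ≤ M₄ := by rw [hM₄]; exact integral_nonneg fun w => by positivity
  have hK0 : 0 ≤ (n : ℝ)⁻¹ * Cχ * (θ ^ 2 * M₄) := by positivity
  have hDens : ∀ v, empiricalDensityField (zipConfig (q, v)) χ = R := fun v => by
    rw [hR]; exact LGFS.empiricalDensityField_zip q v χ
  simp only [hDens]
  -- the centred variables
  obtain ⟨Z, hZ⟩ : ∃ Z : Fin 3 → Fin 3 → (Fin n → V3) → ℝ, ∀ i j v, Z i j v =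
      (∑ a, (n : ℝ)⁻¹ * χ (q a) * ((v a i - u i) * (v a j - u j))) - (if i = j then θ * R else 0) :=
    ⟨_, fun _ _ _ => rfl⟩
  obtain ⟨D, hD⟩ : ∃ D : Fin 3 → (Fin n → V3) → ℝ, ∀ k v, D k v =
      (n : ℝ)⁻¹ * ∑ a, χ (q a) * v a k - (n : ℝ)⁻¹ * ∑ a, χ (q a) * u k := ⟨_, fun _ _ => rfl⟩
  -- pointwise bound
  have hpt : ∀ (v : Fin n → V3) (i j : Fin 3),
      |(∫ y, χ y.1 * (y.2 i * y.2 j) ∂(empiricalMeasure (zipConfig (q, v)))) -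
        empiricalMomentumField (zipConfig (q, v)) χ i * empiricalMomentumField (zipConfig (q, v)) χ j / R -
        (if i = j then R * (2 / 3 * (empiricalEnergyField (zipConfig (q, v)) χ / R -
            ‖empiricalMomentumField (zipConfig (q, v)) χ‖ ^ 2 / (2 * R ^ 2))) else 0)| ≤
      |Z i j v| + (∑ k, |Z k k v|) / 3 + 4 / 3 * ((∑ k, D k v ^ 2) / R) := by
    intro v i j
    have h := kinStatic_abs_kinEntry_le n (zipConfig (q, v)) χ hχ0 u θ i j
    rw [hDens v] at h
    simp only [zipConfig_apply] at h
    simp only [hZ, hD]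
    convert h using 3
  -- the `Z`-variables: `L²`, second moment, `L¹` bound
  have hZmem : ∀ i j, MemLp (Z i j) 2 (velMeasure (fun _ => u) (fun _ => θ) q) := by
    intro i j
    have e : Z i j = fun v => (∑ a, (n : ℝ)⁻¹ * χ (q a) * ((v a i - u i) * (v a j - u j))) -
        (if i = j then θ * R else 0) := funext (hZ i j)
    rw [e, hμv]
    have h1 : ∀ a, MemLp (fun v : Fin n → V3 => (n : ℝ)⁻¹ * χ (q a) * ((v a i - u i) * (v a j - u j))) 2
        (Measure.pi fun _ : Fin n => gaussMeasure u θ) := fun a =>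
      ((kinStatic_memLp_peculiarProd u hθ.le i j).const_mul ((n : ℝ)⁻¹ * χ (q a))).comp_measurePreserving
        (measurePreserving_eval (fun _ : Fin n => gaussMeasure u θ) a)
    exact (memLp_finsetSum _ fun a _ => h1 a).sub (memLp_const _)
  have hZsq : ∀ i j, ∫ v, Z i j v ^ 2 ∂(velMeasure (fun _ => u) (fun _ => θ) q) ≤
      ((n : ℝ)⁻¹ * Cχ * (θ ^ 2 * M₄)) * R := by
    intro i j
    have h := (MesoLLN.integral_sq_sum_sub_pi (μ := fun _ : Fin n => gaussMeasure u θ)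
      (X := fun _ (w : V3) => (w i - u i) * (w j - u j)) (fun _ => kinStatic_memLp_peculiarProd u hθ.le i j)
      (fun a => (n : ℝ)⁻¹ * χ (q a)) (if i = j then θ * R else 0)).2
    have hmean0 : (∑ a, (n : ℝ)⁻¹ * χ (q a) * ∫ w, (w i - u i) * (w j - u j) ∂gaussMeasure u θ) -
        (if i = j then θ * R else 0) = 0 := by
      rw [kinStatic_integral_peculiarProd u hθ]
      split_ifs
      · rw [hR, Finset.mul_sum, Finset.mul_sum, ← Finset.sum_sub_distrib]
        exact Finset.sum_eq_zero fun a _ => by ring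
      · simp
    simp_rw [hZ]
    rw [hμv, h, hmean0, zero_pow two_ne_zero, add_zero, hR]
    exact LGFS.sum_sq_mul_le hκ0 hκC (fun _ => variance_nonneg _ _)
      (fun _ => (kinStatic_variance_peculiarProd_le u hθ i j).trans_eq (by rw [hM₄]))
  have hZabs : ∀ i j, ∫ v, |Z i j v| ∂(velMeasure (fun _ => u) (fun _ => θ) q) ≤
      Real.sqrt ((n : ℝ)⁻¹ * Cχ * (θ ^ 2 * M₄)) * (1 + R) / 2 := fun i j =>
    (LGFS.integral_abs_le_sqrt_of_memLp (hZmem i j)).trans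
      ((Real.sqrt_le_sqrt (hZsq i j)).trans (LGFS.sqrt_mul_le_half hK0 hR0))
  have hZint : ∀ i j, Integrable (Z i j) (velMeasure (fun _ => u) (fun _ => θ) q) := fun i j =>
    (hZmem i j).integrable one_le_two
  -- the momentum fluctuation `D`
  have hDsq : ∀ k, Integrable (fun v => D k v ^ 2) (velMeasure (fun _ => u) (fun _ => θ) q) ∧
      ∫ v, D k v ^ 2 ∂(velMeasure (fun _ => u) (fun _ => θ) q) = ∑ a, ((n : ℝ)⁻¹ * χ (q a)) ^ 2 * θ := by
    intro k
    have h := MesoLLN.integral_momCoord_sq (u₀ := fun _ => u) (θ₀ := fun _ => θ) (fun _ => hθ) q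
      (fun a => χ (q a)) ((n : ℝ)⁻¹ * ∑ a, χ (q a) * u k) k
    rw [sub_self, zero_pow two_ne_zero, add_zero] at h
    simp only [hD]
    exact h
  have hDsum : (∑ k, ∫ v, D k v ^ 2 ∂(velMeasure (fun _ => u) (fun _ => θ) q)) / R ≤ 3 * ((n : ℝ)⁻¹ * Cχ * θ) := by
    have hle : ∑ k, ∫ v, D k v ^ 2 ∂(velMeasure (fun _ => u) (fun _ => θ) q) ≤ 3 * (((n : ℝ)⁻¹ * Cχ * θ) * R) := by
      calc ∑ k, ∫ v, D k v ^ 2 ∂(velMeasure (fun _ => u) (fun _ => θ) q)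
          = ∑ _k : Fin 3, ∑ a, ((n : ℝ)⁻¹ * χ (q a)) ^ 2 * θ := Finset.sum_congr rfl fun k _ => (hDsq k).2
        _ ≤ ∑ _k : Fin 3, ((n : ℝ)⁻¹ * Cχ * θ) * R := Finset.sum_le_sum fun k _ => by
            rw [hR]; exact LGFS.sum_sq_mul_le hκ0 hκC (fun _ => hθ.le) (fun _ => le_rfl)
        _ = 3 * (((n : ℝ)⁻¹ * Cχ * θ) * R) := by
            rw [Finset.sum_const, Finset.card_univ, Fintype.card_fin, nsmul_eq_mul, Nat.cast_ofNat]
    rcases eq_or_lt_of_le hR0 with h0 | hpos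
    · rw [← h0, div_zero]; positivity
    · rw [div_le_iff₀ hpos]; linarith
  -- the dominating function is integrable, with integral at most `2ζ + 4 n⁻¹ C_χ θ`
  have hΨint : ∀ i j, Integrable (fun v => |Z i j v| + (∑ k, |Z k k v|) / 3 + 4 / 3 * ((∑ k, D k v ^ 2) / R))
      (velMeasure (fun _ => u) (fun _ => θ) q) := fun i j =>
    ((hZint i j).abs.add ((integrable_finsetSum _ fun k _ => (hZint k k).abs).div_const 3)).add
      (((integrable_finsetSum _ fun k _ => (hDsq k).1).div_const R).const_mul (4 / 3))
  have hΨle : ∀ i j, ∫ v, (|Z i j v| + (∑ k, |Z k k v|) / 3 + 4 / 3 * ((∑ k, D k v ^ 2) / R))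
      ∂(velMeasure (fun _ => u) (fun _ => θ) q) ≤
      Real.sqrt ((n : ℝ)⁻¹ * Cχ * (θ ^ 2 * M₄)) * (1 + R) + 4 * ((n : ℝ)⁻¹ * Cχ * θ) := by
    intro i j
    have hI1 : Integrable (fun v => |Z i j v|) (velMeasure (fun _ => u) (fun _ => θ) q) := (hZint i j).abs
    have hI2 : Integrable (fun v => (∑ k, |Z k k v|) / 3) (velMeasure (fun _ => u) (fun _ => θ) q) :=
      (integrable_finsetSum _ fun k _ => (hZint k k).abs).div_const 3
    have hI3 : Integrable (fun v => 4 / 3 * ((∑ k, D k v ^ 2) / R)) (velMeasure (fun _ => u) (fun _ => θ) q) :=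
      ((integrable_finsetSum _ fun k _ => (hDsq k).1).div_const R).const_mul (4 / 3)
    have hI12 : Integrable (fun v => |Z i j v| + (∑ k, |Z k k v|) / 3) (velMeasure (fun _ => u) (fun _ => θ) q) :=
      hI1.add hI2
    rw [integral_add hI12 hI3, integral_add hI1 hI2, integral_div, integral_finsetSum _ (fun k _ => (hZint k k).abs),
      integral_const_mul, integral_div, integral_finsetSum _ (fun k _ => (hDsq k).1)]
    have hkk : ∑ k, ∫ v, |Z k k v| ∂(velMeasure (fun _ => u) (fun _ => θ) q) ≤
        3 * (Real.sqrt ((n : ℝ)⁻¹ * Cχ * (θ ^ 2 * M₄)) * (1 + R) / 2) := by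
      calc ∑ k, ∫ v, |Z k k v| ∂(velMeasure (fun _ => u) (fun _ => θ) q)
          ≤ ∑ _k : Fin 3, Real.sqrt ((n : ℝ)⁻¹ * Cχ * (θ ^ 2 * M₄)) * (1 + R) / 2 :=
            Finset.sum_le_sum fun k _ => hZabs k k
        _ = _ := by rw [Finset.sum_const, Finset.card_univ, Fintype.card_fin, nsmul_eq_mul, Nat.cast_ofNat]
    have h1 := hZabs i j
    linarith
  have hΨ0 : ∀ v i j, 0 ≤ |Z i j v| + (∑ k, |Z k k v|) / 3 + 4 / 3 * ((∑ k, D k v ^ 2) / R) := fun v i j =>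
    add_nonneg (add_nonneg (abs_nonneg _) (div_nonneg (Finset.sum_nonneg fun k _ => abs_nonneg _) (by norm_num)))
      (mul_nonneg (by norm_num) (div_nonneg (Finset.sum_nonneg fun k _ => sq_nonneg _) hR0))
  -- conclusion
  have hInt : Integrable (fun v => ∑ i, ∑ j, (|Z i j v| + (∑ k, |Z k k v|) / 3 + 4 / 3 * ((∑ k, D k v ^ 2) / R)))
      (velMeasure (fun _ => u) (fun _ => θ) q) :=
    integrable_finsetSum _ fun i _ => integrable_finsetSum _ fun j _ => hΨint i j
  calc _ ≤ ∫⁻ v, ENNReal.ofReal (∑ i, ∑ j, (|Z i j v| + (∑ k, |Z k k v|) / 3 + 4 / 3 * ((∑ k, D k v ^ 2) / R)))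
        ∂(velMeasure (fun _ => u) (fun _ => θ) q) :=
        lintegral_mono fun v => ENNReal.ofReal_le_ofReal
          (Finset.sum_le_sum fun i _ => Finset.sum_le_sum fun j _ => hpt v i j)
    _ = ENNReal.ofReal (∫ v, ∑ i, ∑ j, (|Z i j v| + (∑ k, |Z k k v|) / 3 + 4 / 3 * ((∑ k, D k v ^ 2) / R))
        ∂(velMeasure (fun _ => u) (fun _ => θ) q)) :=
        (ofReal_integral_eq_lintegral_ofReal hInt (ae_of_all _ fun v =>
          Finset.sum_nonneg fun i _ => Finset.sum_nonneg fun j _ => hΨ0 v i j)).symm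
    _ ≤ _ := by
        refine ENNReal.ofReal_le_ofReal ?_
        rw [integral_finsetSum _ fun i _ => integrable_finsetSum _ fun j _ => hΨint i j]
        calc ∑ i, ∫ v, ∑ j, (|Z i j v| + (∑ k, |Z k k v|) / 3 + 4 / 3 * ((∑ k, D k v ^ 2) / R))
              ∂(velMeasure (fun _ => u) (fun _ => θ) q)
            = ∑ i, ∑ j, ∫ v, (|Z i j v| + (∑ k, |Z k k v|) / 3 + 4 / 3 * ((∑ k, D k v ^ 2) / R))
              ∂(velMeasure (fun _ => u) (fun _ => θ) q) :=
              Finset.sum_congr rfl fun i _ => integral_finsetSum _ fun j _ => hΨint i j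
          _ ≤ ∑ _i : Fin 3, ∑ _j : Fin 3, (Real.sqrt ((n : ℝ)⁻¹ * Cχ * (θ ^ 2 * M₄)) * (1 + R) + 4 * ((n : ℝ)⁻¹ * Cχ * θ)) :=
              Finset.sum_le_sum fun i _ => Finset.sum_le_sum fun j _ => hΨle i j
          _ = _ := by
              rw [Finset.sum_const, Finset.card_univ, Fintype.card_fin, Finset.sum_const, Finset.card_univ,
                Fintype.card_fin, smul_smul, nsmul_eq_mul]
              norm_num
              ring

/-! ### Integration over the local Gibbs measure -/

/-- Testing a `3 × 3` array against entries bounded by `B`: `|Σᵢⱼ fᵢⱼ gᵢⱼ| ≤ B Σᵢⱼ |fᵢⱼ|`. -/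
theorem kinStatic_abs_sum_mul_le {f g : Fin 3 → Fin 3 → ℝ} {B : ℝ} (hg : ∀ i j, |g i j| ≤ B) :
    |∑ i, ∑ j, f i j * g i j| ≤ B * ∑ i, ∑ j, |f i j| := by
  calc |∑ i, ∑ j, f i j * g i j| ≤ ∑ i, |∑ j, f i j * g i j| := Finset.abs_sum_le_sum_abs _ _
    _ ≤ ∑ i, ∑ j, |f i j * g i j| := Finset.sum_le_sum fun i _ => Finset.abs_sum_le_sum_abs _ _
    _ ≤ ∑ i, ∑ j, B * |f i j| := Finset.sum_le_sum fun i _ => Finset.sum_le_sum fun j _ => by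
        rw [abs_mul, mul_comm]
        exact mul_le_mul_of_nonneg_right (hg i j) (abs_nonneg _)
    _ = B * ∑ i, ∑ j, |f i j| := by
        rw [Finset.mul_sum]
        exact Finset.sum_congr rfl fun i _ => (Finset.mul_sum _ _ _).symm

/-- **Gaussian statics of the K-integrand under the homogeneous local Gibbs measure, for a general averaging
kernel.** For `σ ≤ 1/2`, constants `a, θ > 0`, `u`, a jointly measurable kernel `0 ≤ K ≤ C_K` with unit mass in
its centre variable (`∫ K(x, q) dx = 1`) and a matrix field `G` with `|Gᵢⱼ| ≤ B`:
`E_{P_N} |∫ₓ Σᵢⱼ Aᵢⱼ(z, x) Gᵢⱼ(x) dx| ≤ B (18 √((N+1)⁻¹ C_K θ² M₄) + 36 (N+1)⁻¹ C_K θ)`, `A` the K-integrand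
(`Ŝ - m̂⊗m̂/ρ̂ - ρ̂θ̂𝟙` of the `K(x, ·)`-weighted box fields). Proof: `|∫ₓ| ≤ ∫ₓ|·|`, Tonelli, the
disintegration `lintegral_localGibbsMeasure` of `P_N` into positions and Maxwellian velocities, the conditional
bound `kinStatic_lintegral_vel_le` (uniform in the positions after `∫ₓ ρ̂(q, x) dx = 1`), and
`lintegral_posWeight_eq_one`. -/
theorem kinStatic_lintegral_localGibbs_le {σ a θ : ℝ} {u : V3} (hσ : σ ≤ 1 / 2) (ha : 0 < a) (hθ : 0 < θ) (N : ℕ)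
    {K : T3 → T3 → ℝ} {CK : ℝ} (hKm : Measurable fun p : T3 × T3 => K p.1 p.2) (hK0 : ∀ x y, 0 ≤ K x y)
    (hKC : ∀ x y, K x y ≤ CK) (hK1 : ∀ q, ∫ x, K x q = 1) {G : T3 → Fin 3 → Fin 3 → ℝ} {B : ℝ}
    (hGB : ∀ x i j, |G x i j| ≤ B) :
    ∫⁻ z, ENNReal.ofReal (|∫ x, ∑ i, ∑ j, ((∫ y, K x y.1 * (y.2 i * y.2 j) ∂(empiricalMeasure z)) -
        empiricalMomentumField z (K x) i * empiricalMomentumField z (K x) j / empiricalDensityField z (K x) -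
        (if i = j then empiricalDensityField z (K x) * (2 / 3 * (empiricalEnergyField z (K x) / empiricalDensityField z (K x) -
          ‖empiricalMomentumField z (K x)‖ ^ 2 / (2 * empiricalDensityField z (K x) ^ 2))) else 0)) * G x i j|)
      ∂(localGibbsMeasure σ (fun _ => a) (fun _ => u) (fun _ => θ) N) ≤
      ENNReal.ofReal (B * (18 * Real.sqrt (((N + 1 : ℕ) : ℝ)⁻¹ * CK * (θ ^ 2 * ∫ w, ‖w‖ ^ 4 ∂stdGaussian V3)) +
        36 * (((N + 1 : ℕ) : ℝ)⁻¹ * CK * θ))) := by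
  -- the summed absolute integrand `F`
  obtain ⟨F, hF⟩ : ∃ F : Config (N + 1) (Fin 3) T3 → T3 → ℝ, ∀ z x, F z x = ∑ i, ∑ j,
      |(∫ y, K x y.1 * (y.2 i * y.2 j) ∂(empiricalMeasure z)) -
        empiricalMomentumField z (K x) i * empiricalMomentumField z (K x) j / empiricalDensityField z (K x) -
        (if i = j then empiricalDensityField z (K x) * (2 / 3 * (empiricalEnergyField z (K x) / empiricalDensityField z (K x) -
          ‖empiricalMomentumField z (K x)‖ ^ 2 / (2 * empiricalDensityField z (K x) ^ 2))) else 0)| :=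
    ⟨_, fun _ _ => rfl⟩
  haveI : IsProbabilityMeasure (localGibbsMeasure σ (fun _ => a) (fun _ => u) (fun _ => θ) N) :=
    isProbabilityMeasure_localGibbsMeasure continuous_const continuous_const continuous_const (fun _ => ha)
      (fun _ => hθ) hσ N
  have hB0 : 0 ≤ B := (abs_nonneg _).trans (hGB 0 0 0)
  obtain ⟨M₄, hM₄⟩ : ∃ M : ℝ, M = ∫ w, ‖w‖ ^ 4 ∂stdGaussian V3 := ⟨_, rfl⟩
  rw [← hM₄]
  -- joint measurability (B5) and the measurability of the `x`-integral
  have hFm : Measurable fun p : Config (N + 1) (Fin 3) T3 × T3 => ENNReal.ofReal (B * F p.1 p.2) := by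
    simp only [hF]
    exact (measurable_const.mul (Finset.measurable_sum _ fun i _ => Finset.measurable_sum _ fun j _ =>
      (FluxClosureB5.measurable_kinDevIntegrand hKm i j).abs)).ennreal_ofReal
  have hGm : Measurable fun z : Config (N + 1) (Fin 3) T3 => ∫⁻ x, ENNReal.ofReal (B * F z x) :=
    hFm.lintegral_prod_right'
  -- step 1: `|∫ₓ Σ A G| ≤ ∫ₓ B Σ|A|`, in `ℝ≥0∞`
  have hstep1 : ∀ z : Config (N + 1) (Fin 3) T3,
      ENNReal.ofReal (|∫ x, ∑ i, ∑ j, ((∫ y, K x y.1 * (y.2 i * y.2 j) ∂(empiricalMeasure z)) -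
        empiricalMomentumField z (K x) i * empiricalMomentumField z (K x) j / empiricalDensityField z (K x) -
        (if i = j then empiricalDensityField z (K x) * (2 / 3 * (empiricalEnergyField z (K x) / empiricalDensityField z (K x) -
          ‖empiricalMomentumField z (K x)‖ ^ 2 / (2 * empiricalDensityField z (K x) ^ 2))) else 0)) * G x i j|) ≤
      ∫⁻ x, ENNReal.ofReal (B * F z x) := by
    intro z
    refine (ENNReal.ofReal_le_ofReal (abs_integral_le_integral_abs)).trans ?_
    refine (LGFS.ofReal_integral_le_lintegral_ofReal' fun x => abs_nonneg _).trans ?_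
    refine lintegral_mono fun x => ENNReal.ofReal_le_ofReal ?_
    rw [hF]
    exact kinStatic_abs_sum_mul_le (hGB x)
  -- the kernel read at the particles: integrable in the centre, total mass one
  have hKint : ∀ y : T3, Integrable (fun x : T3 => K x y) := fun y =>
    (integrable_const CK).mono' (hKm.comp (measurable_id.prodMk measurable_const)).aestronglyMeasurable
      (ae_of_all _ fun x => by rw [Real.norm_eq_abs, abs_of_nonneg (hK0 x y)]; exact hKC x y)
  have hDint : ∀ q : Fin (N + 1) → T3, Integrable (fun x : T3 => ((N + 1 : ℕ) : ℝ)⁻¹ * ∑ a, K x (q a)) := fun q =>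
    (integrable_finsetSum _ fun a _ => hKint (q a)).const_mul _
  have hDone : ∀ q : Fin (N + 1) → T3, ∫ x : T3, ((N + 1 : ℕ) : ℝ)⁻¹ * ∑ a, K x (q a) = 1 := by
    intro q
    rw [integral_const_mul, integral_finsetSum _ (fun a _ => hKint (q a))]
    simp only [hK1, Finset.sum_const, Finset.card_univ, Fintype.card_fin, nsmul_eq_mul, mul_one]
    exact inv_mul_cancel₀ (Nat.cast_ne_zero.2 (Nat.succ_ne_zero N))
  -- step 2: the bound given the positions, integrated over the centres (uniform in the positions)
  have hq : ∀ q : Fin (N + 1) → T3,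
      ∫⁻ v, (∫⁻ x, ENNReal.ofReal (B * F (zipConfig (q, v)) x)) ∂(velMeasure (fun _ => u) (fun _ => θ) q) ≤
        ENNReal.ofReal (B * (18 * Real.sqrt (((N + 1 : ℕ) : ℝ)⁻¹ * CK * (θ ^ 2 * M₄)) +
          36 * (((N + 1 : ℕ) : ℝ)⁻¹ * CK * θ))) := by
    intro q
    have hsw : AEMeasurable (uncurry fun (v : Fin (N + 1) → V3) (x : T3) => ENNReal.ofReal (B * F (zipConfig (q, v)) x))
        ((velMeasure (fun _ => u) (fun _ => θ) q).prod volume) :=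
      (hFm.comp ((measurable_zipConfig.comp (measurable_const.prodMk measurable_fst)).prodMk measurable_snd)).aemeasurable
    rw [lintegral_lintegral_swap hsw]
    have hx : ∀ x : T3, ∫⁻ v, ENNReal.ofReal (B * F (zipConfig (q, v)) x) ∂(velMeasure (fun _ => u) (fun _ => θ) q) ≤
        ENNReal.ofReal B * ENNReal.ofReal (9 * (Real.sqrt (((N + 1 : ℕ) : ℝ)⁻¹ * CK * (θ ^ 2 * M₄)) *
          (1 + ((N + 1 : ℕ) : ℝ)⁻¹ * ∑ a, K x (q a))) + 36 * (((N + 1 : ℕ) : ℝ)⁻¹ * CK * θ)) := by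
      intro x
      have hA := kinStatic_lintegral_vel_le (u := u) hθ q (χ := K x) (hK0 x) (hKC x)
      rw [← hM₄] at hA
      calc ∫⁻ v, ENNReal.ofReal (B * F (zipConfig (q, v)) x) ∂(velMeasure (fun _ => u) (fun _ => θ) q)
          = ∫⁻ v, ENNReal.ofReal B * ENNReal.ofReal (F (zipConfig (q, v)) x) ∂(velMeasure (fun _ => u) (fun _ => θ) q) :=
            lintegral_congr fun v => by rw [ENNReal.ofReal_mul hB0]
        _ = ENNReal.ofReal B * ∫⁻ v, ENNReal.ofReal (F (zipConfig (q, v)) x) ∂(velMeasure (fun _ => u) (fun _ => θ) q) :=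
            lintegral_const_mul' _ _ ENNReal.ofReal_ne_top
        _ ≤ _ := mul_le_mul' le_rfl (by simp only [hF]; exact hA)
    have hbint : Integrable (fun x : T3 => 9 * (Real.sqrt (((N + 1 : ℕ) : ℝ)⁻¹ * CK * (θ ^ 2 * M₄)) *
        (1 + ((N + 1 : ℕ) : ℝ)⁻¹ * ∑ a, K x (q a))) + 36 * (((N + 1 : ℕ) : ℝ)⁻¹ * CK * θ)) := by
      have h1 : Integrable (fun x : T3 => 1 + ((N + 1 : ℕ) : ℝ)⁻¹ * ∑ a, K x (q a)) :=
        (integrable_const _).add (hDint q)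
      exact ((h1.const_mul _).const_mul _).add (integrable_const _)
    have hb0 : ∀ x : T3, 0 ≤ 9 * (Real.sqrt (((N + 1 : ℕ) : ℝ)⁻¹ * CK * (θ ^ 2 * M₄)) *
        (1 + ((N + 1 : ℕ) : ℝ)⁻¹ * ∑ a, K x (q a))) + 36 * (((N + 1 : ℕ) : ℝ)⁻¹ * CK * θ) := fun x => by
      have : 0 ≤ ((N + 1 : ℕ) : ℝ)⁻¹ * ∑ a, K x (q a) :=
        mul_nonneg (inv_nonneg.2 (Nat.cast_nonneg _)) (Finset.sum_nonneg fun a _ => hK0 _ _)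
      have : 0 ≤ CK := (hK0 0 0).trans (hKC 0 0)
      have := hθ.le
      positivity
    have hbval : ∫ x : T3, (9 * (Real.sqrt (((N + 1 : ℕ) : ℝ)⁻¹ * CK * (θ ^ 2 * M₄)) *
        (1 + ((N + 1 : ℕ) : ℝ)⁻¹ * ∑ a, K x (q a))) + 36 * (((N + 1 : ℕ) : ℝ)⁻¹ * CK * θ)) =
        18 * Real.sqrt (((N + 1 : ℕ) : ℝ)⁻¹ * CK * (θ ^ 2 * M₄)) + 36 * (((N + 1 : ℕ) : ℝ)⁻¹ * CK * θ) := by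
      have h1 : Integrable (fun x : T3 => 1 + ((N + 1 : ℕ) : ℝ)⁻¹ * ∑ a, K x (q a)) :=
        (integrable_const _).add (hDint q)
      have h2 : Integrable (fun x : T3 => Real.sqrt (((N + 1 : ℕ) : ℝ)⁻¹ * CK * (θ ^ 2 * M₄)) *
          (1 + ((N + 1 : ℕ) : ℝ)⁻¹ * ∑ a, K x (q a))) := h1.const_mul _
      have h3 : Integrable (fun x : T3 => 9 * (Real.sqrt (((N + 1 : ℕ) : ℝ)⁻¹ * CK * (θ ^ 2 * M₄)) *
          (1 + ((N + 1 : ℕ) : ℝ)⁻¹ * ∑ a, K x (q a)))) := h2.const_mul _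
      rw [integral_add h3 (integrable_const _), integral_const_mul, integral_const_mul,
        integral_add (integrable_const _) (hDint q), hDone q, integral_const, integral_const, probReal_univ]
      simp only [one_smul]
      ring
    calc ∫⁻ x, ∫⁻ v, ENNReal.ofReal (B * F (zipConfig (q, v)) x) ∂(velMeasure (fun _ => u) (fun _ => θ) q)
        ≤ ∫⁻ x : T3, ENNReal.ofReal B * ENNReal.ofReal (9 * (Real.sqrt (((N + 1 : ℕ) : ℝ)⁻¹ * CK * (θ ^ 2 * M₄)) *
          (1 + ((N + 1 : ℕ) : ℝ)⁻¹ * ∑ a, K x (q a))) + 36 * (((N + 1 : ℕ) : ℝ)⁻¹ * CK * θ)) := lintegral_mono hx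
      _ = ENNReal.ofReal B * ENNReal.ofReal (∫ x : T3, (9 * (Real.sqrt (((N + 1 : ℕ) : ℝ)⁻¹ * CK * (θ ^ 2 * M₄)) *
          (1 + ((N + 1 : ℕ) : ℝ)⁻¹ * ∑ a, K x (q a))) + 36 * (((N + 1 : ℕ) : ℝ)⁻¹ * CK * θ))) := by
          rw [lintegral_const_mul' _ _ ENNReal.ofReal_ne_top, ofReal_integral_eq_lintegral_ofReal hbint (ae_of_all _ hb0)]
      _ = _ := by rw [hbval, ← ENNReal.ofReal_mul hB0]
  -- step 3: disintegrate and assemble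
  refine (lintegral_mono hstep1).trans ?_
  rw [lintegral_localGibbsMeasure (a₀ := fun _ => a) (u₀ := fun _ => u) (θ₀ := fun _ => θ) continuous_const
    continuous_const continuous_const (fun _ => ha.le) (fun _ => hθ) σ N hGm]
  refine (lintegral_mono fun q => mul_le_mul' le_rfl (hq q)).trans ?_
  rw [lintegral_mul_const' _ _ ENNReal.ofReal_ne_top, lintegral_posWeight_eq_one (a₀ := fun _ => a) (u₀ := fun _ => u)
    (θ₀ := fun _ => θ) continuous_const continuous_const continuous_const (fun _ => ha.le) (fun _ => hθ) σ N, one_mul]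

/-! ### The stub -/

/-- **Stub E6 of the rung-0 programme of crux `FluxClosure` (kinetic isotropy, Gaussian statics).** For
`σ ≤ 1/2` and constants `a, θ > 0`, `u` there is `C ≥ 0` (depending on `θ` only) such that for every `N`, every
window `0 < l ≤ 1`, every bounded measurable matrix field `G` (`|Gᵢⱼ| ≤ B`): under the homogeneous local Gibbs
MEASURE `localGibbsMeasure σ a u θ N`, the traceless box peculiar velocity covariance of the cube-kernel box
fields tested against `G` satisfies `E |∫ₓ Σᵢⱼ (Sk - m̂⊗m̂/ρ̂ - ρ̂θ̂𝟙)ᵢⱼ Gᵢⱼ| ≤ C B (((N+1)l³)^{-1/2} + ((N+1)l³)⁻¹)`.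
This is `kinStatic_lintegral_localGibbs_le` for the cube kernel `K_l` (`0 ≤ K_l ≤ l⁻³`, jointly measurable,
`∫ₓ K_l(x, q) dx = 1`), with `C = 18 √(θ² M₄) + 36 θ`, `M₄ = E‖w‖⁴` for the standard Gaussian `w` on `ℝ³`. -/
theorem kineticIsotropy_static_homogeneous : ∀ (σ a θ : ℝ) (u : V3), σ ≤ 1 / 2 → 0 < a → 0 < θ → ∃ C : ℝ, 0 ≤ C ∧ ∀ (N : ℕ) (l : ℝ), 0 < l → l ≤ 1 → ∀ (G : T3 → Fin 3 → Fin 3 → ℝ) (B : ℝ), (∀ i j, Measurable fun x => G x i j) → (∀ x i j, |G x i j| ≤ B) → let K := fun (x y : T3) => indicator {y' : T3 | ∀ i, ‖y' i - x i‖ < l / 2} (fun _ => (l ^ 3)⁻¹) y; let Dn := fun (z : Config (N + 1) (Fin 3) T3) (x : T3) => empiricalDensityField z (K x); let Mm := fun (z : Config (N + 1) (Fin 3) T3) (x : T3) => empiricalMomentumField z (K x); let En := fun (z : Config (N + 1) (Fin 3) T3) (x : T3) => empiricalEnergyField z (K x); let Sk := fun (z : Config (N + 1) (Fin 3) T3)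 (x : T3) (i j : Fin 3) => ∫ y, K x y.1 * (y.2 i * y.2 j) ∂(empiricalMeasure z); let Th := fun (r : ℝ) (m : V3) (E : ℝ) => 2 / 3 * (E / r - ‖m‖ ^ 2 / (2 * r ^ 2)); ∫⁻ z, ENNReal.ofReal (|∫ x, ∑ i, ∑ j, (Sk z x i j - Mm z x i * Mm z x j / Dn z x - (if i = j then Dn z x * Th (Dn z x) (Mm z x) (En z x) else 0)) * G x i j|) ∂(localGibbsMeasure σ (fun _ => a) (fun _ => u) (fun _ => θ) N) ≤ ENNReal.ofReal (C * B * (Real.sqrt ((((N : ℝ) + 1) * l ^ 3)⁻¹) + (((N : ℝ) + 1) * l ^ 3)⁻¹)) := by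
  intro σ a θ u hσ ha hθ
  obtain ⟨M₄, hM₄⟩ : ∃ M : ℝ, M = ∫ w, ‖w‖ ^ 4 ∂stdGaussian V3 := ⟨_, rfl⟩
  refine ⟨18 * Real.sqrt (θ ^ 2 * M₄) + 36 * θ, by positivity, ?_⟩
  intro N l hl hl1 G B _ hGB
  dsimp only
  have h := kinStatic_lintegral_localGibbs_le (u := u) hσ ha hθ N
    (K := fun x y => Set.indicator {y' : T3 | ∀ i, ‖y' i - x i‖ < l / 2} (fun _ => (l ^ 3)⁻¹) y) (CK := (l ^ 3)⁻¹)
    (LGFS.measurable_boxK_uncurry l) (fun x y => LGFS.boxK_nonneg hl.le x y) (fun x y => LGFS.boxK_le hl.le x y)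
    (fun q => FluxClosureK.integral_boxK_left hl hl1 q) hGB
  rw [← hM₄] at h
  refine h.trans (ENNReal.ofReal_le_ofReal ?_)
  have hB0 : 0 ≤ B := (abs_nonneg _).trans (hGB 0 0 0)
  have hn : (((N + 1 : ℕ) : ℝ))⁻¹ * (l ^ 3)⁻¹ = (((N : ℝ) + 1) * l ^ 3)⁻¹ := by
    rw [← mul_inv, Nat.cast_add_one]
  have hs0 : 0 ≤ (((N : ℝ) + 1) * l ^ 3)⁻¹ := by positivity
  have hS0 : 0 ≤ θ ^ 2 * M₄ := by
    have : 0 ≤ M₄ := by rw [hM₄]; exact integral_nonneg fun w => by positivity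
    positivity
  rw [hn, Real.sqrt_mul hs0]
  have hkey : B * (18 * (Real.sqrt (((N : ℝ) + 1) * l ^ 3)⁻¹ * Real.sqrt (θ ^ 2 * M₄)) +
      36 * ((((N : ℝ) + 1) * l ^ 3)⁻¹ * θ)) +
      B * (18 * Real.sqrt (θ ^ 2 * M₄) * (((N : ℝ) + 1) * l ^ 3)⁻¹ + 36 * θ * Real.sqrt (((N : ℝ) + 1) * l ^ 3)⁻¹) =
      (18 * Real.sqrt (θ ^ 2 * M₄) + 36 * θ) * B * (Real.sqrt (((N : ℝ) + 1) * l ^ 3)⁻¹ + (((N : ℝ) + 1) * l ^ 3)⁻¹) := by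
    ring
  have hpos : 0 ≤ B * (18 * Real.sqrt (θ ^ 2 * M₄) * (((N : ℝ) + 1) * l ^ 3)⁻¹ + 36 * θ * Real.sqrt (((N : ℝ) + 1) * l ^ 3)⁻¹) := by
    have := hθ.le
    positivity
  linarith

end FluxClosureEq.E6
end Summit.AtomisticToContinuum.HydrodynamicLimit.Theorems

end
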